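import Summits.CriticalPhenomena.SAWScalingLimit.Theorems.SAWDevelopingMapNoFoldBoundOfInputs
import Summits.CriticalPhenomena.SAWScalingLimit.Theorems.SAWDevelopingMapNoFoldBoundRawDominance

/-!
# `NoFoldBound` — the typed route split (crux-strategist): four sub-cruxes, glue without `InteriorFlattening`

Crux `NoFoldBound` (stmt-CriticalPhenomena-8296) of the route `SAWDevelopingMap` (sub-problem `SAWScalingLimit`).
Ten lead seats of the line `Ideator3Sketch` have reduced the crux to named conjecture-grade inputs; the citable
composition `noFoldBound_of_inputs` (OfInputs, p124749) still carries the SIBLING crux (M) `InteriorFlattening`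
(stmt-CriticalPhenomena-8297) as a fifth hypothesis, so it cannot serve as the glue of a route split of `NoFoldBound`
(a split glue must have the type `C₁ → … → C_k → NoFoldBound` over the children alone). This file supplies the glue
of the split actually filed on the route:

* `C₁` **SlitLoopFifth** — the slit returning-loop series at criticality is `≤ 1/5` (the registered stub
  `stub_slitLoopFifth` verbatim; `SourceLoopBound`, stmt-8300, with the explicit constant the depth-2 algebra needs;
  numerically `sup = 0.1175 ± 0.0015`; NECESSARY in kind: `sourceLoopBound_of_noFoldBound`, p88850);
* `C₂` **RawDominance**, `C₃` **RawDominanceSrc** — middle-port dominance of the RAW first-arrival masses at depth-2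
  vertices, touching neighbour off the source / equal to the source vertex (the registered stubs verbatim; pure
  critical-SAW Harnack-type statements; necessary form `8·min ≤ 15·N_mid + 5·max` is a theorem, RawNoStarvation);
* `C₄` **NoFoldDeep3** — the crux's own inequality, with one `k < 1`, at the vertices of DEPTH ≥ 3 (off the source,
  all neighbours and all second neighbours in `Λ`): the regime where first arrivals are no longer rigid (wrapped
  winding classes, `chain_rigidity` bands) and where (M) takes over at large depth; trivially NECESSARY
  (`noFoldDeep3_of_noFoldBound`), and SUFFICIENT together with `C₁–C₃` (`noFoldBound_of_subs`), so the split is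
  tight: `NoFoldBound → C₄` and `C₁ → C₂ → C₃ → C₄ → NoFoldBound`.

Proof of the glue: depth `≤ 2` (on the source mid-edge, a neighbour outside, or a second neighbour outside) is the
landed milestone `noFold_collarTwo` (CollarTwo, p122922) fed with the dressed dominance hypotheses obtained from the
raw ones by `dom_of_rawDominance` / `domSrc_of_rawDominanceSrc` (RawDominance, p124748); every other vertex is of
depth `≥ 3` and is covered by `C₄`; `k = max k₁ k₂`. The last theorem records how the live line reaches `C₄`:
`noFoldDeep3_of_collarDepthThree_of_interiorFlattening` — the v11 stub `stub_collarDepthThree` (every radius `R`)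
plus (M) give `C₄` (`depthThree_interior_of_hyp`, OfInputs), so the registered skeleton v11 proves the four children
with (M) exactly as before. [folklore assembly]
-/

noncomputable section

open scoped BigOperators
open Literature.Probability.LatticeModels Literature.Probability.RandomPlanarGeometry.SAW

namespace Summit.CriticalPhenomena.SAWScalingLimit.Theorems.SAWDevelopingMapNoFoldBound

/-- **The glue of the route split `NoFoldBound ⇐ SlitLoopFifth ∧ RawDominance ∧ RawDominanceSrc ∧ NoFoldDeep3`.**
Under (C₁) slit returning loops `≤ 1/5`, (C₂)/(C₃) raw middle-port dominance at depth-2 vertices in both touching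
positions, and (C₄) the no-fold inequality with one constant at every vertex of depth `≥ 3`, the parafermionic
observable at `(x_c, 5/8)` never folds, uniformly: `NoFoldBound`. Depth `≤ 2` is `noFold_collarTwo` with the dressed
dominance supplied by `dom_of_rawDominance` / `domSrc_of_rawDominanceSrc`; the rest is (C₄). [folklore assembly] -/
theorem noFoldBound_of_subs
    (hL : ∀ (Λ : Finset HexVertex), hexDomainSimplyConnected Λ →
      ∀ u v w₁ w₂ : HexVertex, u ∉ Λ → v ∈ Λ → hexGraph.Adj v u → hexGraph.Adj v w₁ →
        hexGraph.Adj v w₂ → u ≠ w₁ → u ≠ w₂ → w₁ ≠ w₂ →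
        (∑ γ : HexMidEdgeSAW (Λ.erase v) s(v, w₁) s(v, w₂), hexCriticalFugacity ^ γ.length) ≤ 1 / 5)
    (hdom : ∀ (Λ : Finset HexVertex), hexDomainSimplyConnected Λ → ∀ a ∈ hexDomainBoundary Λ,
      ∀ v ∈ Λ, v ∉ a → ∀ w₀ w₁ w₂ x y : HexVertex, hexGraph.Adj v w₀ → hexGraph.Adj v w₁ →
      hexGraph.Adj v w₂ → w₀ ≠ w₁ → w₁ ≠ w₂ → w₀ ≠ w₂ → w₀ ∈ Λ → w₀ ∉ a →
      winding [hexMidpoint s(w₀, v), hexCenter v, hexMidpoint s(v, w₁)] = Real.pi / 3 →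
      hexGraph.Adj w₀ x → hexGraph.Adj w₀ y → v ≠ x → x ≠ y → v ≠ y → x ∉ Λ →
      let N : HexVertex → ℝ := fun w =>
        ∑ γ : HexMidEdgeSAW Λ a s(v, w), if v ∉ γ.verts then hexCriticalFugacity ^ γ.length else 0
      (winding [hexMidpoint s(y, w₀), hexCenter w₀, hexMidpoint s(w₀, v)] = Real.pi / 3 →
          min (N w₀) (N w₂) ≤ N w₁) ∧
        (winding [hexMidpoint s(y, w₀), hexCenter w₀, hexMidpoint s(w₀, v)] = -(Real.pi / 3) →
          min (N w₀) (N w₁) ≤ N w₂))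
    (hdomSrc : ∀ (Λ : Finset HexVertex), hexDomainSimplyConnected Λ → ∀ a ∈ hexDomainBoundary Λ,
      ∀ v ∈ Λ, v ∉ a → ∀ w₀ w₁ w₂ x y : HexVertex, hexGraph.Adj v w₀ → hexGraph.Adj v w₁ →
      hexGraph.Adj v w₂ → w₀ ≠ w₁ → w₁ ≠ w₂ → w₀ ≠ w₂ → w₀ ∈ Λ → a = s(x, w₀) →
      winding [hexMidpoint s(w₀, v), hexCenter v, hexMidpoint s(v, w₁)] = Real.pi / 3 →
      hexGraph.Adj w₀ x → hexGraph.Adj w₀ y → v ≠ x → x ≠ y → v ≠ y → x ∉ Λ →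
      let N : HexVertex → ℝ := fun w =>
        ∑ γ : HexMidEdgeSAW Λ a s(v, w), if v ∉ γ.verts then hexCriticalFugacity ^ γ.length else 0
      (winding [hexMidpoint s(y, w₀), hexCenter w₀, hexMidpoint s(w₀, v)] = Real.pi / 3 →
          min (N w₀) (N w₂) ≤ N w₁) ∧
        (winding [hexMidpoint s(y, w₀), hexCenter w₀, hexMidpoint s(w₀, v)] = -(Real.pi / 3) →
          min (N w₀) (N w₁) ≤ N w₂))
    (hDeep : ∃ k : ℝ, k < 1 ∧ ∀ (Λ : Finset HexVertex), hexDomainSimplyConnected Λ →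
      ∀ a ∈ hexDomainBoundary Λ, ∀ v ∈ Λ, v ∉ a → (∀ u : HexVertex, hexGraph.Adj v u → u ∈ Λ) →
      (∀ w x : HexVertex, hexGraph.Adj v w → hexGraph.Adj w x → x ≠ v → x ∈ Λ) →
      ∀ w₀ w₁ w₂ : HexVertex, hexGraph.Adj v w₀ → hexGraph.Adj v w₁ → hexGraph.Adj v w₂ →
      w₀ ≠ w₁ → w₁ ≠ w₂ → w₀ ≠ w₂ →
      let F : Sym2 HexVertex → ℂ := hexParafermionicObservable Λ a hexCriticalFugacity (5 / 8)
      let ω : ℂ := Complex.exp (2 * Real.pi * Complex.I / 3)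
      ‖F s(v, w₀) + ω * F s(v, w₁) + ω ^ 2 * F s(v, w₂)‖ ≤
        k * ‖F s(v, w₀) + F s(v, w₁) + F s(v, w₂)‖) :
    Summit.CriticalPhenomena.SAWScalingLimit.Theses.SAWDevelopingMap.NoFoldBound := by
  obtain ⟨k₁, hk₁, H₁⟩ :=
    noFold_collarTwo hL (dom_of_rawDominance hdom) (domSrc_of_rawDominanceSrc hdomSrc)
  obtain ⟨k₂, hk₂, H₂⟩ := hDeep
  refine ⟨max k₁ k₂, max_lt hk₁ hk₂, ?_⟩
  intro Λ hΛ a ha v hv w₀ w₁ w₂ h₀ h₁ h₂ h₀₁ h₁₂ h₀₂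
  by_cases hb : v ∈ a ∨ (∃ u : HexVertex, hexGraph.Adj v u ∧ u ∉ Λ) ∨
      ∃ w x : HexVertex, hexGraph.Adj v w ∧ hexGraph.Adj w x ∧ x ≠ v ∧ x ∉ Λ
  · -- the collar of depth ≤ 2
    have h := H₁ Λ hΛ a ha v hv hb w₀ w₁ w₂ h₀ h₁ h₂ h₀₁ h₁₂ h₀₂
    dsimp only at h ⊢
    exact h.trans (mul_le_mul_of_nonneg_right (le_max_left _ _) (norm_nonneg _))
  · -- depth ≥ 3
    push Not at hb
    obtain ⟨hva, hint', h2'⟩ := hb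
    have h := H₂ Λ hΛ a ha v hv hva (fun u hu => hint' u hu)
      (fun w x hvw hwx hxv => h2' w x hvw hwx hxv) w₀ w₁ w₂ h₀ h₁ h₂ h₀₁ h₁₂ h₀₂
    dsimp only at h ⊢
    exact h.trans (mul_le_mul_of_nonneg_right (le_max_right _ _) (norm_nonneg _))

/-- **Three-child form of the same glue** (the two dominance positions as one conjunctive child): `SlitLoopFifth →
(RawDominance ∧ RawDominanceSrc) → NoFoldDeep3 → NoFoldBound`. [folklore assembly] -/
theorem noFoldBound_of_subs3
    (hL : ∀ (Λ : Finset HexVertex), hexDomainSimplyConnected Λ →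
      ∀ u v w₁ w₂ : HexVertex, u ∉ Λ → v ∈ Λ → hexGraph.Adj v u → hexGraph.Adj v w₁ →
        hexGraph.Adj v w₂ → u ≠ w₁ → u ≠ w₂ → w₁ ≠ w₂ →
        (∑ γ : HexMidEdgeSAW (Λ.erase v) s(v, w₁) s(v, w₂), hexCriticalFugacity ^ γ.length) ≤ 1 / 5)
    (hdomBoth : (∀ (Λ : Finset HexVertex), hexDomainSimplyConnected Λ → ∀ a ∈ hexDomainBoundary Λ,
      ∀ v ∈ Λ, v ∉ a → ∀ w₀ w₁ w₂ x y : HexVertex, hexGraph.Adj v w₀ → hexGraph.Adj v w₁ →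
      hexGraph.Adj v w₂ → w₀ ≠ w₁ → w₁ ≠ w₂ → w₀ ≠ w₂ → w₀ ∈ Λ → w₀ ∉ a →
      winding [hexMidpoint s(w₀, v), hexCenter v, hexMidpoint s(v, w₁)] = Real.pi / 3 →
      hexGraph.Adj w₀ x → hexGraph.Adj w₀ y → v ≠ x → x ≠ y → v ≠ y → x ∉ Λ →
      let N : HexVertex → ℝ := fun w =>
        ∑ γ : HexMidEdgeSAW Λ a s(v, w), if v ∉ γ.verts then hexCriticalFugacity ^ γ.length else 0
      (winding [hexMidpoint s(y, w₀), hexCenter w₀, hexMidpoint s(w₀, v)] = Real.pi / 3 →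
          min (N w₀) (N w₂) ≤ N w₁) ∧
        (winding [hexMidpoint s(y, w₀), hexCenter w₀, hexMidpoint s(w₀, v)] = -(Real.pi / 3) →
          min (N w₀) (N w₁) ≤ N w₂)) ∧
      (∀ (Λ : Finset HexVertex), hexDomainSimplyConnected Λ → ∀ a ∈ hexDomainBoundary Λ,
      ∀ v ∈ Λ, v ∉ a → ∀ w₀ w₁ w₂ x y : HexVertex, hexGraph.Adj v w₀ → hexGraph.Adj v w₁ →
      hexGraph.Adj v w₂ → w₀ ≠ w₁ → w₁ ≠ w₂ → w₀ ≠ w₂ → w₀ ∈ Λ → a = s(x, w₀) →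
      winding [hexMidpoint s(w₀, v), hexCenter v, hexMidpoint s(v, w₁)] = Real.pi / 3 →
      hexGraph.Adj w₀ x → hexGraph.Adj w₀ y → v ≠ x → x ≠ y → v ≠ y → x ∉ Λ →
      let N : HexVertex → ℝ := fun w =>
        ∑ γ : HexMidEdgeSAW Λ a s(v, w), if v ∉ γ.verts then hexCriticalFugacity ^ γ.length else 0
      (winding [hexMidpoint s(y, w₀), hexCenter w₀, hexMidpoint s(w₀, v)] = Real.pi / 3 →
          min (N w₀) (N w₂) ≤ N w₁) ∧
        (winding [hexMidpoint s(y, w₀), hexCenter w₀, hexMidpoint s(w₀, v)] = -(Real.pi / 3) →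
          min (N w₀) (N w₁) ≤ N w₂)))
    (hDeep : ∃ k : ℝ, k < 1 ∧ ∀ (Λ : Finset HexVertex), hexDomainSimplyConnected Λ →
      ∀ a ∈ hexDomainBoundary Λ, ∀ v ∈ Λ, v ∉ a → (∀ u : HexVertex, hexGraph.Adj v u → u ∈ Λ) →
      (∀ w x : HexVertex, hexGraph.Adj v w → hexGraph.Adj w x → x ≠ v → x ∈ Λ) →
      ∀ w₀ w₁ w₂ : HexVertex, hexGraph.Adj v w₀ → hexGraph.Adj v w₁ → hexGraph.Adj v w₂ →
      w₀ ≠ w₁ → w₁ ≠ w₂ → w₀ ≠ w₂ →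
      let F : Sym2 HexVertex → ℂ := hexParafermionicObservable Λ a hexCriticalFugacity (5 / 8)
      let ω : ℂ := Complex.exp (2 * Real.pi * Complex.I / 3)
      ‖F s(v, w₀) + ω * F s(v, w₁) + ω ^ 2 * F s(v, w₂)‖ ≤
        k * ‖F s(v, w₀) + F s(v, w₁) + F s(v, w₂)‖) :
    Summit.CriticalPhenomena.SAWScalingLimit.Theses.SAWDevelopingMap.NoFoldBound :=
  noFoldBound_of_subs hL hdomBoth.1 hdomBoth.2 hDeep

/-- **The fourth child is necessary**: `NoFoldBound` restricted to the vertices of depth `≥ 3` (a restriction of the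
crux's universal quantifiers). [folklore] -/
theorem noFoldDeep3_of_noFoldBound
    (hK : Summit.CriticalPhenomena.SAWScalingLimit.Theses.SAWDevelopingMap.NoFoldBound) :
    ∃ k : ℝ, k < 1 ∧ ∀ (Λ : Finset HexVertex), hexDomainSimplyConnected Λ →
      ∀ a ∈ hexDomainBoundary Λ, ∀ v ∈ Λ, v ∉ a → (∀ u : HexVertex, hexGraph.Adj v u → u ∈ Λ) →
      (∀ w x : HexVertex, hexGraph.Adj v w → hexGraph.Adj w x → x ≠ v → x ∈ Λ) →
      ∀ w₀ w₁ w₂ : HexVertex, hexGraph.Adj v w₀ → hexGraph.Adj v w₁ → hexGraph.Adj v w₂ →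
      w₀ ≠ w₁ → w₁ ≠ w₂ → w₀ ≠ w₂ →
      let F : Sym2 HexVertex → ℂ := hexParafermionicObservable Λ a hexCriticalFugacity (5 / 8)
      let ω : ℂ := Complex.exp (2 * Real.pi * Complex.I / 3)
      ‖F s(v, w₀) + ω * F s(v, w₁) + ω ^ 2 * F s(v, w₂)‖ ≤
        k * ‖F s(v, w₀) + F s(v, w₁) + F s(v, w₂)‖ := by
  obtain ⟨k, hk, H⟩ := hK
  exact ⟨k, hk, fun Λ hΛ a ha v hv _ _ _ w₀ w₁ w₂ h₀ h₁ h₂ h₀₁ h₁₂ h₀₂ =>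
    H Λ hΛ a ha v hv w₀ w₁ w₂ h₀ h₁ h₂ h₀₁ h₁₂ h₀₂⟩

/-- **How the live line reaches the fourth child**: the registered v11 stub `stub_collarDepthThree` (slit coherence
at the depth-≥-3 collar, one `k_R < 1` for every radius `R`) together with the sibling crux (M) `InteriorFlattening`
gives `NoFoldDeep3`: `R₀`-deep vertices (`R₀` from (M) at `ε = 1/2`) are flattened by (M), the others are
`depthThree_interior_of_hyp _ R₀`; `k = max k₂ (1/2)`. [folklore assembly] -/
theorem noFoldDeep3_of_collarDepthThree_of_interiorFlattening
    (h3 : ∀ R : ℝ, ∃ k : ℝ, k < 1 ∧ ∀ (Λ : Finset HexVertex), hexDomainSimplyConnected Λ →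
      ∀ a ∈ hexDomainBoundary Λ, ∀ v ∈ Λ, v ∉ a → (∀ u : HexVertex, hexGraph.Adj v u → u ∈ Λ) →
      (∀ w : HexVertex, hexGraph.Adj v w → ∃ y : HexVertex, hexGraph.Adj w y ∧ y ≠ v ∧ y ∈ Λ) →
      (∃ w : HexVertex, dist (hexCenter w) (hexCenter v) ≤ R ∧ w ∉ Λ) →
      (¬ ∃ w x : HexVertex, hexGraph.Adj v w ∧ hexGraph.Adj w x ∧ x ≠ v ∧ x ∉ Λ ∧ w ∉ a) →
      (¬ ∃ w : HexVertex, hexGraph.Adj v w ∧ w ∈ a) →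
      ∀ w₀ w₁ w₂ : HexVertex, hexGraph.Adj v w₀ → hexGraph.Adj v w₁ → hexGraph.Adj v w₂ →
      w₀ ≠ w₁ → w₁ ≠ w₂ → w₀ ≠ w₂ →
      winding [hexMidpoint s(w₀, v), hexCenter v, hexMidpoint s(v, w₁)] = Real.pi / 3 →
      let x : ℝ := hexCriticalFugacity
      let α : ℝ := 1 + 2 * hexCriticalFugacity * Real.cos (5 * Real.pi / 24)
      let β : ℝ := 1 + 2 * hexCriticalFugacity * Real.cos (11 * Real.pi / 24)
      let ω : ℂ := Complex.exp (2 * Real.pi * Complex.I / 3)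
      let Z : (w p q : HexVertex) → HexMidEdgeSAW Λ a s(v, w) → ℝ :=
        fun w p q (γ : HexMidEdgeSAW Λ a s(v, w)) =>
        ∑ δ : HexMidEdgeSAW ((Λ \ γ.verts.toFinset).erase v) s(v, p) s(v, q), x ^ δ.length
      let B : (w p q : HexVertex) → ℂ := fun w p q =>
        ∑ γ : HexMidEdgeSAW Λ a s(v, w), if v ∉ γ.verts then
          γ.weight x (5 / 8) * ((β + Real.sqrt 3 * x * Z w p q γ : ℝ) : ℂ) else 0
      let S : (w p q : HexVertex) → ℂ := fun w p q =>
        ∑ γ : HexMidEdgeSAW Λ a s(v, w), if v ∉ γ.verts then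
          γ.weight x (5 / 8) * ((α - Real.sqrt 3 * x * Z w p q γ : ℝ) : ℂ) else 0
      ‖B w₀ w₁ w₂ + ω * B w₁ w₂ w₀ + ω ^ 2 * B w₂ w₀ w₁‖ ≤
        k * ‖S w₀ w₁ w₂ + S w₁ w₂ w₀ + S w₂ w₀ w₁‖)
    (hM : Summit.CriticalPhenomena.SAWScalingLimit.Theses.SAWDevelopingMap.InteriorFlattening) :
    ∃ k : ℝ, k < 1 ∧ ∀ (Λ : Finset HexVertex), hexDomainSimplyConnected Λ →
      ∀ a ∈ hexDomainBoundary Λ, ∀ v ∈ Λ, v ∉ a → (∀ u : HexVertex, hexGraph.Adj v u → u ∈ Λ) →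
      (∀ w x : HexVertex, hexGraph.Adj v w → hexGraph.Adj w x → x ≠ v → x ∈ Λ) →
      ∀ w₀ w₁ w₂ : HexVertex, hexGraph.Adj v w₀ → hexGraph.Adj v w₁ → hexGraph.Adj v w₂ →
      w₀ ≠ w₁ → w₁ ≠ w₂ → w₀ ≠ w₂ →
      let F : Sym2 HexVertex → ℂ := hexParafermionicObservable Λ a hexCriticalFugacity (5 / 8)
      let ω : ℂ := Complex.exp (2 * Real.pi * Complex.I / 3)
      ‖F s(v, w₀) + ω * F s(v, w₁) + ω ^ 2 * F s(v, w₂)‖ ≤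
        k * ‖F s(v, w₀) + F s(v, w₁) + F s(v, w₂)‖ := by
  obtain ⟨R₀, HM⟩ := hM (1 / 2) one_half_pos
  obtain ⟨k₂, hk₂, H₂⟩ := depthThree_interior_of_hyp h3 R₀
  refine ⟨max k₂ (1 / 2), max_lt hk₂ one_half_lt_one, ?_⟩
  intro Λ hΛ a ha v hv hva hint h2 w₀ w₁ w₂ h₀ h₁ h₂ h₀₁ h₁₂ h₀₂
  by_cases hd : ∀ w : HexVertex, dist (hexCenter w) (hexCenter v) ≤ R₀ → w ∈ Λ
  · -- `R₀`-deep vertices: interior flattening at `ε = 1/2`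
    have h := HM Λ hΛ a ha v hv hd w₀ w₁ w₂ h₀ h₁ h₂ h₀₁ h₁₂ h₀₂
    dsimp only at h ⊢
    exact h.trans (mul_le_mul_of_nonneg_right (le_max_right _ _) (norm_nonneg _))
  · -- depth ≥ 3, not `R₀`-deep
    push Not at hd
    have h := H₂ Λ hΛ a ha v hv hva hint h2 hd w₀ w₁ w₂ h₀ h₁ h₂ h₀₁ h₁₂ h₀₂
    dsimp only at h ⊢
    exact h.trans (mul_le_mul_of_nonneg_right (le_max_left _ _) (norm_nonneg _))

end Summit.CriticalPhenomena.SAWScalingLimit.Theorems.SAWDevelopingMapNoFoldBound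

end
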